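import Mathlib
import HarnessLib
import Summits.AtomisticToContinuum.HydrodynamicLimit.Theorems.OneFlightGossipEngineKineticCurrentsWindowLDApriori

/-!
# The ideal-gas kernel inside the hard-sphere gas: `KineticCurrentsWindowLD`'s orthogonality is load-bearing

Route `OneFlightGossipEngine`, items stmt-AtomisticToContinuum-9530 (`KineticCurrentsWindowLD`) /
stmt-AtomisticToContinuum-14662 (`KineticCurrentsWindowLDUniform`). The member `A = 𝟙, b = 0` of the items'
functional class is the kinetic-energy symbol `F(x,v) = ‖v - u₀(x)‖²`; it violates the orthogonality
hypotheses (`∫ F M ≠ 0`). For it the window average is a CONSERVED quantity at `u₀ = 0`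
(`∑ᵢ w⁻¹∫₀ʷ ‖vᵢ(r)‖² dr = 2E(z)`, `HardSphereFlow.configEnergy_flow`), so under the homogeneous Gibbs law
its window exponential moment is EXACTLY the static Gaussian one, `(1 - 2βθ)^{-3(N+1)/2}`
(`lintegral_exp_window_energy_const_eq`), for every flow, every window and every `N`; in the items'
currency it is `≥ exp(3βθ(N+1))` (`exp_mul_le_lintegral_exp_window_energy_const`), so the conclusion
"`≤ exp(ε(N+1))` for every `ε > 0` once `τ, N` are large" fails for this functional at every `β > 0`:
any proof of the items must use the orthogonality to the collision invariants (window averaging does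
nothing to conserved quantities — the ideal-gas kernel of `BoltzmannHypothesisBarrier`, realised inside
the interacting gas by the energy). Inputs: the a priori file (`sum_window_integral_norm_sq_eq`,
`lintegral_exp_mul_norm_sub_sq_gaussMeasure`) and the disintegration of local Gibbs laws
(`lintegral_localGibbsMeasure`).

References: H. Spohn, *Large Scale Dynamics of Interacting Particles* (1991), Part I §2.3; Olla–Varadhan–Yau,
Comm. Math. Phys. 155 (1993) 523, §2.
-/

noncomputable section

open MeasureTheory Real
open scoped ENNReal

namespace Summit.AtomisticToContinuum.HydrodynamicLimit.Theorems

open Literature.Analysis.FluidPDE Literature.MathematicalPhysics.KineticTheory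

/-- **Exponential moments of the kinetic energy under the HOMOGENEOUS Gibbs law, exactly**: for
constant profiles `(a, 0, θ)`, `σ ≤ 1/2` and `γθ < 1`:
`∫ exp(γ E(z)) dλ^N(z) = ((1 - γθ)^{-3/2})^{N+1}`. [folklore] -/
theorem lintegral_exp_mul_configEnergy_const_eq {a θ : ℝ} (ha0 : 0 < a) (hθ0 : 0 < θ) {σ : ℝ}
    (hσ2 : σ ≤ 1 / 2) (N : ℕ) (Φ : HardSphereFlow (Torus.geometry (Fin 3)) (hsDiameter σ N) (N + 1))
    {γ : ℝ} (hγθ : γ * θ < 1) :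
    ∫⁻ z, ENNReal.ofReal (Real.exp (γ * configEnergy z))
        ∂(localGibbsLaw σ (fun _ => a) (fun _ => (0 : V3)) (fun _ => θ) N Φ) =
      ENNReal.ofReal (((1 - γ * θ) ^ (-(3 : ℝ) / 2)) ^ (N + 1)) := by
  have ha : Continuous fun _ : T3 => a := continuous_const
  have hθ : Continuous fun _ : T3 => θ := continuous_const
  have hu : Continuous fun _ : T3 => (0 : V3) := continuous_const
  haveI := isProbabilityMeasure_localGibbsMeasure ha hθ hu (fun _ => ha0) (fun _ => hθ0) hσ2 N
  have hk : 0 < 1 - γ * θ := by linarith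
  set K : ℝ := (1 - γ * θ) ^ (-(3 : ℝ) / 2) with hK
  have hK0 : 0 ≤ K := Real.rpow_nonneg hk.le _
  set G : Config (N + 1) (Fin 3) T3 → ℝ≥0∞ := fun z => ENNReal.ofReal (Real.exp (γ * configEnergy z))
    with hG
  have hEm : Measurable fun z : Config (N + 1) (Fin 3) T3 => configEnergy z := by
    unfold configEnergy
    exact measurable_const.mul (Finset.measurable_sum _ fun i _ =>
      ((measurable_pi_apply i).snd.norm.pow_const 2))
  have hGm : Measurable G := (Real.measurable_exp.comp (measurable_const.mul hEm)).ennreal_ofReal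
  have hfac : ∀ (x : Fin (N + 1) → T3) (v : Fin (N + 1) → V3),
      G (zipConfig (x, v)) = ∏ i, ENNReal.ofReal (Real.exp (γ / 2 * ‖v i - 0‖ ^ 2)) := by
    intro x v
    simp only [hG, configEnergy, zipConfig_apply, sub_zero]
    rw [Finset.mul_sum, Finset.mul_sum, Real.exp_sum, ENNReal.ofReal_prod_of_nonneg
      (fun i _ => Real.exp_nonneg _)]
    refine Finset.prod_congr rfl fun i _ => ?_
    congr 2
    ring
  have hbase : (1 - 2 * (γ / 2) * θ) ^ (-(Module.finrank ℝ V3 : ℝ) / 2) = K := by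
    rw [hK, finrank_euclideanSpace_fin]
    norm_num
    ring_nf
  have hvel : ∀ x : Fin (N + 1) → T3,
      ∫⁻ v, G (zipConfig (x, v)) ∂velMeasure (fun _ => (0 : V3)) (fun _ => θ) x =
        ENNReal.ofReal (K ^ (N + 1)) := by
    intro x
    simp_rw [hfac x]
    rw [velMeasure, lintegral_fintype_prod_eq_prod' _ (fun i =>
      (by fun_prop : Measurable fun w : V3 => ENNReal.ofReal (Real.exp (γ / 2 * ‖w - 0‖ ^ 2))))]
    have h2 : 2 * (γ / 2) * θ < 1 := by linarith
    simp_rw [lintegral_exp_mul_norm_sub_sq_gaussMeasure hθ0 h2 (0 : V3), hbase]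
    rw [Finset.prod_const, Finset.card_univ, Fintype.card_fin, ENNReal.ofReal_pow hK0]
  rw [localGibbsLaw_eq, lintegral_localGibbsMeasure ha hθ hu (fun _ => ha0.le) (fun _ => hθ0) σ N hGm]
  simp_rw [hvel]
  have hρm : Measurable fun x : Fin (N + 1) → T3 => ENNReal.ofReal
      ((canonicalPartition (Torus.geometry (Fin 3)) (hsDiameter σ N) (N + 1)
        (localGibbsProfile (fun _ => a) (fun _ => (0 : V3)) (fun _ => θ)))⁻¹ *
          posWeight (fun _ => a) (hsDiameter σ N) (N + 1) x) :=
    (measurable_const.mul (measurable_posWeight ha _ _)).ennreal_ofReal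
  rw [lintegral_mul_const _ hρm,
    lintegral_posWeight_eq_one ha hθ hu (fun _ => ha0.le) (fun _ => hθ0) σ N, one_mul]

/-- **The window average of the energy symbol is the conserved energy**: on a good orbit,
`∑ᵢ w⁻¹ ∫₀ʷ ‖vᵢ(r)‖² dr = 2 E(z)` for every `w > 0`. [folklore] -/
theorem sum_window_average_norm_sq_eq {ε : ℝ} {n : ℕ}
    (Φ : HardSphereFlow (Torus.geometry (Fin 3)) ε n) {z : Config n (Fin 3) T3}
    (hz : z ∈ Φ.good) {w : ℝ} (hw : 0 < w) :
    ∑ i, w⁻¹ * ∫ r in (0 : ℝ)..w, ‖(Φ.flow r z i).2‖ ^ 2 = 2 * configEnergy z := by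
  rw [← Finset.mul_sum, (sum_window_integral_norm_sq_eq Φ hz w).2]
  field_simp

/-- **The ideal-gas kernel inside the hard-sphere gas.** For constant profiles `(a, 0, θ)`, EVERY
hard-sphere flow, EVERY window `w > 0`, every `N` and `2βθ < 1`, the window exponential moment of
the kinetic-energy symbol `F(x,v) = ‖v‖²` (the member `A = 𝟙, b = 0` of the items' class, NOT
orthogonal to `1` and `‖v‖²`) is EXACTLY the static one:
`∫ exp(β ∑ᵢ w⁻¹∫₀ʷ ‖vᵢ(r)‖² dr) dλ^N = (1 - 2βθ)^{-3(N+1)/2}` — energy conservation makes the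
window average the conserved energy, whose Gibbs law is a product of Gaussians. Hence the
per-particle window pressure of this functional is `(3/2) log (1/(1-2βθ)) ≥ 3βθ`, independent of
`τ`, `N` and the flow: the conclusion of `KineticCurrentsWindowLD` fails for it, i.e. the
orthogonality hypotheses of the item are load-bearing (window averaging does nothing to conserved
quantities). [folklore] -/
theorem lintegral_exp_window_energy_const_eq {a θ : ℝ} (ha0 : 0 < a) (hθ0 : 0 < θ) {σ : ℝ}
    (hσ2 : σ ≤ 1 / 2) (N : ℕ) (Φ : HardSphereFlow (Torus.geometry (Fin 3)) (hsDiameter σ N) (N + 1))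
    {β : ℝ} (hβθ : 2 * β * θ < 1) {w : ℝ} (hw : 0 < w) :
    ∫⁻ z, ENNReal.ofReal (Real.exp (β * ∑ i, w⁻¹ * ∫ r in (0 : ℝ)..w, ‖(Φ.flow r z i).2‖ ^ 2))
        ∂(localGibbsLaw σ (fun _ => a) (fun _ => (0 : V3)) (fun _ => θ) N Φ) =
      ENNReal.ofReal (((1 - 2 * β * θ) ^ (-(3 : ℝ) / 2)) ^ (N + 1)) := by
  have hae : ∀ᵐ z ∂(localGibbsLaw σ (fun _ => a) (fun _ => (0 : V3)) (fun _ => θ) N Φ),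
      ENNReal.ofReal (Real.exp (β * ∑ i, w⁻¹ * ∫ r in (0 : ℝ)..w, ‖(Φ.flow r z i).2‖ ^ 2)) =
        ENNReal.ofReal (Real.exp ((2 * β) * configEnergy z)) := by
    filter_upwards [ae_mem_good_localGibbsLaw σ (fun _ => a) (fun _ => (0 : V3)) (fun _ => θ) N Φ]
      with z hz
    rw [sum_window_average_norm_sq_eq Φ hz hw]
    ring_nf
  rw [lintegral_congr_ae hae, lintegral_exp_mul_configEnergy_const_eq ha0 hθ0 hσ2 N Φ (by linarith)]

/-- **Lower bound in the currency of the item**: under the hypotheses of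
`lintegral_exp_window_energy_const_eq`, the window exponential moment of the energy
symbol is at least `exp(3βθ(N+1))` (from `-log(1-x) ≥ x`), so it exceeds `exp(ε(N+1))` for every
`ε < 3βθ`, whatever `τ`, `N₀` and the flow. [folklore] -/
theorem exp_mul_le_lintegral_exp_window_energy_const {a θ : ℝ} (ha0 : 0 < a) (hθ0 : 0 < θ) {σ : ℝ}
    (hσ2 : σ ≤ 1 / 2) (N : ℕ) (Φ : HardSphereFlow (Torus.geometry (Fin 3)) (hsDiameter σ N) (N + 1))
    {β : ℝ} (hβθ : 2 * β * θ < 1) {w : ℝ} (hw : 0 < w) :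
    ENNReal.ofReal (Real.exp (3 * β * θ * ((N : ℝ) + 1))) ≤
      ∫⁻ z, ENNReal.ofReal (Real.exp (β * ∑ i, w⁻¹ * ∫ r in (0 : ℝ)..w, ‖(Φ.flow r z i).2‖ ^ 2))
        ∂(localGibbsLaw σ (fun _ => a) (fun _ => (0 : V3)) (fun _ => θ) N Φ) := by
  rw [lintegral_exp_window_energy_const_eq ha0 hθ0 hσ2 N Φ hβθ hw]
  refine ENNReal.ofReal_le_ofReal ?_
  have hk : 0 < 1 - 2 * β * θ := by linarith
  -- `exp(3βθ) ≤ (1-2βθ)^{-3/2}` since `exp(2βθ) · (1 - 2βθ) ≤ 1`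
  have h1 : Real.exp (3 * β * θ) ≤ (1 - 2 * β * θ) ^ (-(3 : ℝ) / 2) := by
    have hlog : Real.log (1 - 2 * β * θ) ≤ -(2 * β * θ) := by
      have := Real.log_le_sub_one_of_pos hk
      linarith
    rw [Real.rpow_def_of_pos hk, Real.exp_le_exp]
    nlinarith
  calc Real.exp (3 * β * θ * ((N : ℝ) + 1))
      = Real.exp (3 * β * θ) ^ (N + 1) := by
        rw [← Real.exp_nat_mul]; congr 1; push_cast; ring
    _ ≤ ((1 - 2 * β * θ) ^ (-(3 : ℝ) / 2)) ^ (N + 1) :=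
        pow_le_pow_left₀ (Real.exp_nonneg _) h1 _

end Summit.AtomisticToContinuum.HydrodynamicLimit.Theorems

end
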